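import Literature.AlgebraicGeometry.Resolution.ValuationDefect
import Mathlib.RingTheory.LaurentSeries
import Mathlib.FieldTheory.KummerPolynomial
import Mathlib.FieldTheory.PurelyInseparable.PerfectClosure
import Mathlib.RingTheory.Algebraic.Cardinality
import Mathlib.Algebra.CharP.IntermediateField
import Mathlib.Algebra.CharP.Lemmas
import Mathlib.Algebra.Polynomial.Expand
import Mathlib.Algebra.Field.ZMod
import HarnessLib

/-!
# Defect exists: F. K. Schmidt's immediate purely inseparable extension (companion of `ValuationDefect.lean`)

Topic: `Literature/AlgebraicGeometry/Resolution` (valued function fields). PROVED companion of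
`ValuationDefect.lean` (the vocabulary of F.-V. Kuhlmann, *Elimination of ramification I: The
generalized stability theorem*, Trans. AMS 362 (2010) = arXiv:1003.5678, §1, p. 3: `(K, v)` is
defectless in `L` when `[L : K] = ∑ eᵢ fᵢ`, and a *defectless (stable) field* when it is
defectless in every finite extension — `IsDefectlessIn`, `IsDefectlessField`). That file's
`IsDefectlessField K O` is a DEFINITION (a predicate of the valued field `(K, O)`), not a closed
statement: here we PROVE that its universal closure is false, i.e. that **defect exists**
(`exists_not_isDefectlessField`, `not_forall_isDefectlessField`), complementing the proved
positive instance `isDefectlessField_top` (trivially valued fields, `ValuationDefectProofs.lean`)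
and Kuhlmann's Cor. 2.12 (residue characteristic `0` ⇒ defectless; p. 3: "Every valued field of
residue characteristic `0` is defectless … So we will always assume in the following that
`p = char(K̄) > 0`"). The mechanism is that of Kuhlmann 2010, §2.3 (p. 7 of the arXiv version):
"If `[L:K] = p` then `(L|K,v)` has non-trivial defect if and only if it is immediate, i.e.,
`(vL:vK) = 1` and `[Lv:Kv] = 1`."

## Content (everything PROVED; all `[folklore]`)

Let `p` be a prime and `𝕄 = 𝔽_p((X))` (`(ZMod p)⸨X⸩`) with its `X`-adic valuation ring
`𝔽_p⟦X⟧ = Valued.v.valuationSubring`.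

* **The defect criterion inside `𝔽_p((X))`** (`SchmidtDefect.*`): for a subfield `K ⊆ 𝕄`
  (an `IntermediateField (ZMod p) 𝕄`) and `z ∈ 𝕄` with `X ∈ K`, `z^p ∈ K`, `z ∉ K`, the extension
  `L = K(z)` with the restricted valuation rings `K° = K ∩ 𝔽_p⟦X⟧`, `L° = L ∩ 𝔽_p⟦X⟧` has
  - `[L : K] = p` (`T^p - z^p` is irreducible over `K`, `X_pow_sub_C_irreducible_of_prime`) —
    `finrank_eq`;
  - a UNIQUE extension of `K°` to `L`, namely `L°` (`L/K` is purely inseparable: `x ∈ O' ↔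
    x^{pⁿ} ∈ O'` and `x^{pⁿ} ∈ K`) — `eq_comap_of_comap_eq`;
  - `e = 1` (every `|x|`, `x ∈ L^×`, is `|X|^m`, `m ∈ ℤ`, and `X ∈ K`) — `ramificationIndex_eq_one`;
  - `f = 1` (every `x ∈ L°` is congruent to its constant coefficient `x(0) ∈ 𝔽_p ⊆ K`) —
    `inertiaDegree_eq_one`;
  hence `∑ eᵢ fᵢ = 1 < p = [L : K]`: `(K, K°)` is not defectless in `L` (`not_isDefectlessIn`) and
  not a defectless field (`not_isDefectlessField`).
* **F. K. Schmidt's example** (`SchmidtDefect.not_isDefectlessField_adjoin`): for `z`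
  transcendental over `𝔽_p(X) = (ZMod p)⟮X⟯ ⊆ 𝕄`, `K = 𝔽_p(X, z^p)` qualifies (`z ∉ F(zⁿ)` for a
  transcendental `z` and `n ≥ 2`, `not_mem_adjoin_pow_of_transcendental`); such `z` exist since
  `𝔽_p(X)` is countable and `𝕄` is not (`exists_transcendental_laurentSeries`). So for every
  prime `p` there is a valued field of characteristic `p` that is not defectless
  (`exists_not_isDefectlessField`), and `¬ ∀ K O, IsDefectlessField K O`
  (`not_forall_isDefectlessField`).
* Generic lemmas: `mem_valuationSubring_iff_pow_mem`, `valuation_le_of_div_mem`,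
  `mem_nonunits_comap_iff`, `mem_nonunits_valuationSubring_iff`,
  `residue_eq_residue_of_sub_mem_nonunits`, `finrank_top_subfield`; on `k⸨X⸩`:
  `coeff_eq_zero_of_valuation_le_one`, `valuation_sub_C_coeff_zero_le` (`|f - f(0)| ≤ |X|` for
  `|f| ≤ 1`), `valuation_single_one_one_zpow` (`|X^m| = exp (-m)`), `valuation_C_le_one`.

## Sources

* F.-V. Kuhlmann, Trans. AMS 362 (2010) 5697–5727 = arXiv:1003.5678: §1 (p. 3), §2.3 (p. 7,
  incl. Cor. 2.12).
* The example of a discrete valuation ring (`𝔽_p⟦X⟧ ∩ 𝔽_p(X, z^p)`) whose degree-`p` purely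
  inseparable extension is immediate goes back to F. K. Schmidt (1936) and is textbook folklore;
  no single source is followed, every statement below is proved in full.

## Rendering notes

* `K` is (the subtype of) an `IntermediateField (ZMod p) (ZMod p)⸨X⸩`, `L` the subtype of
  `(↥K)⟮z⟯ : IntermediateField ↥K (ZMod p)⸨X⸩`; `K° := 𝔽_p⟦X⟧.comap (algebraMap K 𝕄)` and
  `L° := 𝔽_p⟦X⟧.comap (algebraMap L 𝕄)`. All types live in `Type`, as `IsDefectlessField.{0}`
  requires; `𝔽_p(X)` is realized as `(ZMod p)⟮X⟯ ⊆ 𝕄` (no `RatFunc`), and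
  `𝔽_p(X, z^p) = (ZMod p)⟮X, z^p⟯` is compared with `(ZMod p)⟮X⟯⟮z^p⟯` through
  `IntermediateField.adjoin_simple_adjoin_simple`.
* Elaboration on the tower `↥(↥K)⟮z⟯ → 𝕄` is delicate: definitional unfolding of
  `algebraMap K L` / `algebraMap L 𝕄` is prohibitively expensive, so the proofs go through
  `IsScalarTower.algebraMap_apply` and the generic valuation-ring lemmas above, never through
  `rfl` on the tower, and one subtraction in `L` is spelled `HSub.hSub` (the `binop%` elaborator
  times out on `x - a` there).
-/

noncomputable section

open scoped LaurentSeries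
open Polynomial IntermediateField WithZero IsLocalRing

namespace Literature.AlgebraicGeometry.Resolution

universe u

section General

variable {L : Type u} [Field L]

/-- For a valuation ring `A` of a field `L` and `n ≠ 0`: `x ∈ A ↔ x ^ n ∈ A`. [folklore] -/
theorem mem_valuationSubring_iff_pow_mem (A : ValuationSubring L) (x : L) {n : ℕ} (hn : n ≠ 0) :
    x ∈ A ↔ x ^ n ∈ A := by
  refine ⟨fun h => pow_mem h n, fun h => ?_⟩
  rw [← A.valuation_le_one_iff] at h ⊢
  rw [map_pow] at h
  by_contra hlt
  exact (one_lt_pow₀ (lt_of_not_ge hlt) hn).not_ge h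

/-- `A.valuation x ≤ A.valuation y` as soon as `x / y ∈ A` (`y ≠ 0`). [folklore] -/
theorem valuation_le_of_div_mem (A : ValuationSubring L) {x y : L} (hy : y ≠ 0) (h : x / y ∈ A) :
    A.valuation x ≤ A.valuation y :=
  (A.valuation_le_iff x y).mpr ⟨⟨x / y, h⟩, div_mul_cancel₀ x hy⟩

/-- Non-units of a restricted valuation ring `φ⁻¹(A)`: `w` is a non-unit iff `φ w` is. [folklore] -/
theorem mem_nonunits_comap_iff {K' : Type*} [Field K'] (A : ValuationSubring L) (φ : K' →+* L)
    (w : K') : w ∈ (A.comap φ).nonunits ↔ φ w ∈ A.nonunits := by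
  rw [ValuationSubring.mem_nonunits_iff_or, ValuationSubring.mem_nonunits_iff_or,
    ValuationSubring.mem_comap, map_inv₀, map_eq_zero]

/-- Non-units of the valuation ring of a valuation `v`: exactly the `y` with `v y < 1`. [folklore] -/
theorem mem_nonunits_valuationSubring_iff {Γ : Type*} [LinearOrderedCommGroupWithZero Γ]
    (v : Valuation L Γ) (y : L) : y ∈ v.valuationSubring.nonunits ↔ v y < 1 := by
  rw [ValuationSubring.mem_nonunits_iff_or, Valuation.mem_valuationSubring_iff, map_inv₀]
  rcases eq_or_ne y 0 with rfl | hy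
  · simp
  · rw [inv_le_one₀ ((Valuation.pos_iff v).mpr hy), not_le]
    exact ⟨fun h => h.resolve_left hy, fun h => Or.inr h⟩

/-- Elements of a valuation ring congruent modulo non-units have the same residue. [folklore] -/
theorem residue_eq_residue_of_sub_mem_nonunits (A : ValuationSubring L) {x a : L} (hx : x ∈ A)
    (ha : a ∈ A) (h : x - a ∈ A.nonunits) :
    IsLocalRing.residue A ⟨x, hx⟩ = IsLocalRing.residue A ⟨a, ha⟩ := by
  rw [← sub_eq_zero, ← map_sub, IsLocalRing.residue_eq_zero_iff,
    ← ValuationSubring.coe_mem_nonunits_iff]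
  exact h

/-- `[F : ⊤] = 1` for the top subfield of a field `F`. [folklore] -/
theorem finrank_top_subfield (F : Type*) [Field F] : Module.finrank (⊤ : Subfield F) F = 1 := by
  have h := Algebra.finrank_eq_of_equiv_equiv
    (Subfield.topEquiv : (⊤ : Subfield F) ≃+* F) (RingEquiv.refl F) (by ext; rfl)
  rw [h, Module.finrank_self]

/-- A transcendental element `z` over `F` does not lie in `F(zⁿ)` for `n ≥ 2`: writing
`z = r(zⁿ)/s(zⁿ)` gives the polynomial identity `X·s(Xⁿ) = r(Xⁿ)`, impossible by comparing the
coefficients of `X^{kn+1}`. [folklore] -/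
theorem not_mem_adjoin_pow_of_transcendental {F E : Type*} [Field F] [Field E] [Algebra F E]
    {z : E} (hz : Transcendental F z) {n : ℕ} (hn : 2 ≤ n) : z ∉ F⟮z ^ n⟯ := by
  have hn0 : 0 < n := by omega
  have htr := transcendental_iff.mp hz
  intro h
  rw [mem_adjoin_simple_iff] at h
  obtain ⟨r, s, h⟩ := h
  rw [← expand_aeval n r z, ← expand_aeval n s z] at h
  by_cases hs : aeval z (expand F n s) = 0
  · rw [hs, div_zero] at h
    have hX : (X : F[X]) = 0 := htr X (by rw [aeval_X, h])
    exact X_ne_zero hX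
  · have hzero : X * expand F n s - expand F n r = 0 := by
      refine htr _ ?_
      rw [map_sub, map_mul, aeval_X, (eq_div_iff hs).mp h, sub_self]
    have hs0 : s = 0 := by
      ext k
      have hk := congrArg (fun q : F[X] => q.coeff (k * n + 1)) hzero
      simp only [coeff_sub, coeff_zero, coeff_X_mul, coeff_expand_mul hn0] at hk
      rw [coeff_expand hn0, if_neg, sub_zero] at hk
      · rw [hk, coeff_zero]
      · intro hdvd
        have h1 : n ∣ 1 := (Nat.dvd_add_right (dvd_mul_left n k)).mp hdvd
        have : n ≤ 1 := Nat.le_of_dvd one_pos h1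
        omega
    apply hs
    rw [hs0, map_zero, map_zero]

end General

section LaurentSeriesFacts

variable (k : Type*) [Field k]

/-- A Laurent series of valuation `≤ 1` has no polar part. [folklore] -/
theorem coeff_eq_zero_of_valuation_le_one {f : k⸨X⸩} (hf : Valued.v f ≤ (1 : ℤᵐ⁰)) {n : ℤ}
    (hn : n < 0) : f.coeff n = 0 := by
  have hf' : Valued.v f ≤ exp (-(0 : ℤ)) := by rwa [neg_zero, exp_zero]
  exact (LaurentSeries.valuation_le_iff_coeff_lt_eq_zero k).mp hf' n hn

/-- A Laurent series of valuation `≤ 1` is congruent to its constant coefficient modulo the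
maximal ideal: `|f - f(0)| ≤ |X|`. [folklore] -/
theorem valuation_sub_C_coeff_zero_le {f : k⸨X⸩} (hf : Valued.v f ≤ (1 : ℤᵐ⁰)) :
    Valued.v (f - HahnSeries.C (f.coeff 0)) ≤ exp (-(1 : ℤ)) := by
  refine (LaurentSeries.valuation_le_iff_coeff_lt_eq_zero k).mpr fun n hn => ?_
  rw [HahnSeries.coeff_sub, HahnSeries.C_apply]
  by_cases h0 : n = 0
  · subst h0
    rw [HahnSeries.coeff_single_same, sub_self]
  · have hn' : n < 0 := lt_of_le_of_ne (Int.lt_add_one_iff.mp hn) h0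
    rw [coeff_eq_zero_of_valuation_le_one k hf hn', HahnSeries.coeff_single_of_ne h0, sub_zero]

/-- `|X ^ m| = exp (-m)` for the `X`-adic valuation of `k⸨X⸩`, `m ∈ ℤ`. [folklore] -/
theorem valuation_single_one_one_zpow (m : ℤ) :
    Valued.v ((HahnSeries.single (1 : ℤ) (1 : k) : k⸨X⸩) ^ m) = exp (-m) := by
  rw [← RatFunc.single_zpow, LaurentSeries.valuation_single_zpow k]

/-- Power series (in particular constants) have valuation `≤ 1`. [folklore] -/
theorem valuation_C_le_one (a : k) : Valued.v (HahnSeries.C a : k⸨X⸩) ≤ (1 : ℤᵐ⁰) :=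
  (LaurentSeries.val_le_one_iff_eq_coe k _).mpr ⟨PowerSeries.C a, HahnSeries.ofPowerSeries_C a⟩

end LaurentSeriesFacts

section Countability

variable (p : ℕ) [hp : Fact p.Prime]

/-- A simple extension `𝔽_p(α)` inside any field is countable (its elements are the
`r(α)/s(α)`, `r, s ∈ 𝔽_p[X]`). [folklore] -/
theorem countable_adjoin_simple {E : Type*} [Field E] [Algebra (ZMod p) E] (α : E) :
    Countable (↥(ZMod p)⟮α⟯) := by
  have hpoly : Countable (ZMod p)[X] := by
    rw [← Cardinal.mk_le_aleph0_iff]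
    exact Polynomial.cardinalMk_le_max.trans (max_le Cardinal.mk_le_aleph0 le_rfl)
  refine Function.Surjective.countable
    (f := fun rs : (ZMod p)[X] × (ZMod p)[X] =>
      (⟨aeval α rs.1 / aeval α rs.2, (mem_adjoin_simple_iff (ZMod p) _).mpr ⟨rs.1, rs.2, rfl⟩⟩ :
        ↥(ZMod p)⟮α⟯)) ?_
  rintro ⟨y, hy⟩
  obtain ⟨r, s, h⟩ := (mem_adjoin_simple_iff (ZMod p) y).mp hy
  exact ⟨(r, s), Subtype.ext h.symm⟩

/-- `𝔽_p((X))` is uncountable (Cantor's diagonal on the coefficient sequences). [folklore] -/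
theorem not_countable_laurentSeries : ¬ Countable ((ZMod p)⸨X⸩) := by
  intro h
  have hinj : Function.Injective
      (fun g : ℕ → ZMod p => ((PowerSeries.mk g : PowerSeries (ZMod p)) : (ZMod p)⸨X⸩)) := by
    intro g₁ g₂ hg
    funext n
    have := congrArg (fun f : (ZMod p)⸨X⸩ => f.coeff n) hg
    simpa [LaurentSeries.coeff_coe_powerSeries] using this
  haveI : Countable (ℕ → ZMod p) := hinj.countable
  obtain ⟨f, hf⟩ := exists_surjective_nat (ℕ → ZMod p)
  obtain ⟨n, hn⟩ := hf (fun k => f k k + 1)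
  have h1 := congrFun hn n
  have h2 : (1 : ZMod p) = 0 := by linear_combination -h1
  exact one_ne_zero h2

/-- Over any simple extension `𝔽_p(α) ⊆ 𝔽_p((X))` there is a transcendental Laurent series
(a cardinality count: the elements algebraic over a countable subfield form a countable set).
[folklore] -/
theorem exists_transcendental_laurentSeries (α : (ZMod p)⸨X⸩) :
    ∃ z : (ZMod p)⸨X⸩, Transcendental (↥(ZMod p)⟮α⟯) z := by
  by_contra h
  simp only [not_exists] at h
  replace h : ∀ z : (ZMod p)⸨X⸩, IsAlgebraic (↥(ZMod p)⟮α⟯) z := fun z => not_not.mp (h z)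
  haveI : Algebra.IsAlgebraic (↥(ZMod p)⟮α⟯) ((ZMod p)⸨X⸩) := ⟨h⟩
  haveI := countable_adjoin_simple p α
  have hle := Algebra.IsAlgebraic.cardinalMk_le_max (↥(ZMod p)⟮α⟯) ((ZMod p)⸨X⸩)
  have hM : Cardinal.mk ((ZMod p)⸨X⸩) ≤ Cardinal.aleph0 :=
    hle.trans (max_le Cardinal.mk_le_aleph0 le_rfl)
  exact not_countable_laurentSeries p (Cardinal.mk_le_aleph0_iff.mp hM)

end Countability

/-! ### The defect criterion inside `𝔽_p((X))` and F. K. Schmidt's example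

Throughout, `K` is a subfield of `𝕄 = 𝔽_p((X))` (an intermediate field of `𝕄/𝔽_p`), `z ∈ 𝕄`,
`L = K(z) = (↥K)⟮z⟯`, and the valuation rings are the restrictions
`K° = 𝔽_p⟦X⟧.comap (K → 𝕄)`, `L° = 𝔽_p⟦X⟧.comap (L → 𝕄)` of `𝔽_p⟦X⟧ = Valued.v.valuationSubring`.
The hypotheses `X ∈ K`, `z^p ∈ K`, `z ∉ K` are introduced where needed. -/

namespace SchmidtDefect

variable (p : ℕ) [hp : Fact p.Prime] (K : IntermediateField (ZMod p) ((ZMod p)⸨X⸩))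
  (z : (ZMod p)⸨X⸩)

/-- `𝕄 = 𝔽_p((X))` has characteristic `p`. [folklore] -/
theorem charP_laurentSeries : CharP ((ZMod p)⸨X⸩) p :=
  charP_of_injective_algebraMap (algebraMap (ZMod p) ((ZMod p)⸨X⸩)).injective p

/-- If `z^p ∈ K` then `z` is a root of `T^p - z^p ∈ K[T]`, so integral over `K`. [folklore] -/
theorem isIntegral_gen (hzp : z ^ p ∈ K) : IsIntegral (↥K) z := by
  refine ⟨X ^ p - C ⟨z ^ p, hzp⟩, monic_X_pow_sub_C _ hp.out.ne_zero, ?_⟩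
  rw [eval₂_sub, eval₂_X_pow, eval₂_C]
  exact sub_self _

/-- For `z^p ∈ K`, `z ∉ K`, the minimal polynomial of `z` over `K` is `T^p - z^p` (irreducible
since `z^p` is not a `p`-th power in `K`: a `p`-th root `b ∈ K` would satisfy `(b - z)^p = 0` in
`𝕄`). [folklore] -/
theorem minpoly_gen (hzp : z ^ p ∈ K) (hz : z ∉ K) : minpoly (↥K) z = X ^ p - C ⟨z ^ p, hzp⟩ := by
  haveI : CharP ((ZMod p)⸨X⸩) p := charP_laurentSeries p
  refine (minpoly.eq_of_irreducible_of_monic ?_ ?_ (monic_X_pow_sub_C _ hp.out.ne_zero)).symm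
  · refine X_pow_sub_C_irreducible_of_prime hp.out fun b hb => hz ?_
    have hb' : (b : (ZMod p)⸨X⸩) ^ p = z ^ p := by
      have := congrArg (algebraMap (↥K) ((ZMod p)⸨X⸩)) hb
      rwa [map_pow] at this
    have hbz : (b : (ZMod p)⸨X⸩) = z := by
      have h0 : ((b : (ZMod p)⸨X⸩) - z) ^ p = 0 := by rw [sub_pow_char, hb', sub_self]
      exact sub_eq_zero.mp (pow_eq_zero_iff hp.out.ne_zero |>.mp h0)
    have hb2 := b.2
    rw [hbz] at hb2
    exact hb2
  · rw [map_sub, map_pow, aeval_X, aeval_C]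
    exact sub_self _

/-- `[K(z) : K] = p` for `z^p ∈ K`, `z ∉ K`. [folklore] -/
theorem finrank_eq (hzp : z ^ p ∈ K) (hz : z ∉ K) : Module.finrank (↥K) (↥(↥K)⟮z⟯) = p := by
  rw [adjoin.finrank (isIntegral_gen p K z hzp), minpoly_gen p K z hzp hz, natDegree_X_pow_sub_C]

/-- `K(z)/K` is purely inseparable when `z^p ∈ K`. [folklore] -/
theorem isPurelyInseparable_gen (hzp : z ^ p ∈ K) : IsPurelyInseparable (↥K) (↥(↥K)⟮z⟯) :=
  (isPurelyInseparable_adjoin_simple_iff_pow_mem (↥K) ((ZMod p)⸨X⸩) p).mpr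
    ⟨1, ⟨z ^ p, hzp⟩, by rw [pow_one]; rfl⟩

/-- **Uniqueness of the extension**: for `z^p ∈ K` the only valuation ring of the purely
inseparable extension `L = K(z)` lying over `K° = K ∩ 𝔽_p⟦X⟧` is `L° = L ∩ 𝔽_p⟦X⟧` (for
`x ∈ L` some `x^{pⁿ}` lies in `K`, and `x ∈ O' ↔ x^{pⁿ} ∈ O'`). [folklore] -/
theorem eq_comap_of_comap_eq (hzp : z ^ p ∈ K) (O' : ValuationSubring (↥(↥K)⟮z⟯))
    (h : O'.comap (algebraMap (↥K) (↥(↥K)⟮z⟯)) =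
      Valued.v.valuationSubring.comap (algebraMap (↥K) ((ZMod p)⸨X⸩))) :
    O' = Valued.v.valuationSubring.comap (algebraMap (↥(↥K)⟮z⟯) ((ZMod p)⸨X⸩)) := by
  haveI := isPurelyInseparable_gen p K z hzp
  ext x
  obtain ⟨n, y, hy⟩ := IsPurelyInseparable.pow_mem (↥K) p x
  have hpn : p ^ n ≠ 0 := pow_ne_zero n hp.out.ne_zero
  rw [mem_valuationSubring_iff_pow_mem O' x hpn, mem_valuationSubring_iff_pow_mem _ x hpn, ← hy,
    ← ValuationSubring.mem_comap, h, ValuationSubring.mem_comap, ValuationSubring.mem_comap,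
    ← IsScalarTower.algebraMap_apply]

/-- `L° ∩ K = K°` for the restrictions of `𝔽_p⟦X⟧` to `L = K(z)` and `K`. [folklore] -/
theorem comap_comap_eq :
    (Valued.v.valuationSubring.comap (algebraMap (↥(↥K)⟮z⟯) ((ZMod p)⸨X⸩))).comap
        (algebraMap (↥K) (↥(↥K)⟮z⟯)) =
      Valued.v.valuationSubring.comap (algebraMap (↥K) ((ZMod p)⸨X⸩)) := by
  ext y
  rw [ValuationSubring.mem_comap, ValuationSubring.mem_comap, ValuationSubring.mem_comap,
    ← IsScalarTower.algebraMap_apply]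

/-- **`e = 1`** when `X ∈ K`: every value `|x|`, `x ∈ L^×`, is the value `|X^m|` of an element of
`K` (the value group of `𝔽_p((X))` is `ℤ·|X|`). [folklore] -/
theorem valueSubgroup_eq_top (ht : (HahnSeries.single 1 1 : (ZMod p)⸨X⸩) ∈ K) :
    valueSubgroup (↥K) (Valued.v.valuationSubring.comap (algebraMap (↥(↥K)⟮z⟯) ((ZMod p)⸨X⸩)))
      = ⊤ := by
  set OL := Valued.v.valuationSubring.comap (algebraMap (↥(↥K)⟮z⟯) ((ZMod p)⸨X⸩)) with hOL
  refine eq_top_iff.mpr fun γ _ => ?_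
  obtain ⟨x, hx⟩ := OL.valuation_surjective (γ : ValuationSubring.ValueGroup OL)
  have hx0 : x ≠ 0 := by
    rintro rfl
    exact γ.ne_zero (by rw [← hx, map_zero])
  have hxM : (x : (ZMod p)⸨X⸩) ≠ 0 := fun h0 => hx0 (by exact_mod_cast h0)
  have hv0 : Valued.v (x : (ZMod p)⸨X⸩) ≠ (0 : ℤᵐ⁰) := (Valuation.ne_zero_iff _).mpr hxM
  set m : ℤ := log (Valued.v (x : (ZMod p)⸨X⸩)) with hm
  have hvx : Valued.v (x : (ZMod p)⸨X⸩) = exp m := (exp_log hv0).symm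
  -- the element `X^(-m)` of `K`
  have htK0 : (⟨HahnSeries.single 1 1, ht⟩ : ↥K) ≠ 0 := fun h0 =>
    one_ne_zero (HahnSeries.single_eq_zero_iff.mp (congrArg Subtype.val h0))
  set c : ↥K := (⟨HahnSeries.single 1 1, ht⟩ : ↥K) ^ (-m) with hc
  have hc0 : c ≠ 0 := zpow_ne_zero _ htK0
  have hcM : algebraMap (↥K) ((ZMod p)⸨X⸩) c = HahnSeries.single 1 1 ^ (-m) := by
    rw [hc, map_zpow₀]
    rfl
  have hvc : Valued.v (algebraMap (↥K) ((ZMod p)⸨X⸩) c) = exp m := by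
    rw [hcM, valuation_single_one_one_zpow, neg_neg]
  have hcL0 : algebraMap (↥K) (↥(↥K)⟮z⟯) c ≠ 0 := (_root_.map_ne_zero _).mpr hc0
  have hcLM : ((algebraMap (↥K) (↥(↥K)⟮z⟯) c : ↥(↥K)⟮z⟯) : (ZMod p)⸨X⸩) =
      algebraMap (↥K) ((ZMod p)⸨X⸩) c :=
    (IsScalarTower.algebraMap_apply (↥K) (↥(↥K)⟮z⟯) ((ZMod p)⸨X⸩) c).symm
  -- `|x| = |c|` in `𝕄`, hence for `L°`
  have h1 : x / algebraMap (↥K) (↥(↥K)⟮z⟯) c ∈ OL := by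
    rw [hOL, ValuationSubring.mem_comap, Valuation.mem_valuationSubring_iff,
      IntermediateField.algebraMap_apply]
    push_cast
    rw [hcLM, map_div₀, hvx, hvc, div_self exp_ne_zero]
  have h2 : algebraMap (↥K) (↥(↥K)⟮z⟯) c / x ∈ OL := by
    rw [hOL, ValuationSubring.mem_comap, Valuation.mem_valuationSubring_iff,
      IntermediateField.algebraMap_apply]
    push_cast
    rw [hcLM, map_div₀, hvx, hvc, div_self exp_ne_zero]
  have hval : OL.valuation x = OL.valuation (algebraMap (↥K) (↥(↥K)⟮z⟯) c) :=
    le_antisymm (valuation_le_of_div_mem OL hcL0 h1) (valuation_le_of_div_mem OL hx0 h2)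
  exact (mem_valueSubgroup_iff (↥K) OL γ).mpr ⟨c, hc0, by rw [← hx, hval]⟩

/-- **`e_{L/K} = 1`** for `L° = K(z) ∩ 𝔽_p⟦X⟧` over `K ∋ X`. [folklore] -/
theorem ramificationIndex_eq_one (ht : (HahnSeries.single 1 1 : (ZMod p)⸨X⸩) ∈ K) :
    ramificationIndex (↥K)
      (Valued.v.valuationSubring.comap (algebraMap (↥(↥K)⟮z⟯) ((ZMod p)⸨X⸩))) = 1 := by
  unfold ramificationIndex
  rw [Subgroup.index_eq_one]
  exact valueSubgroup_eq_top p K z ht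

/-- **Residues of `L°` are constants**: every `x ∈ L° = K(z) ∩ 𝔽_p⟦X⟧` is congruent modulo the
maximal ideal to its constant coefficient `x(0) ∈ 𝔽_p ⊆ K` (the residue field of `𝔽_p((X))` is
`𝔽_p`). The subtraction in `L` is spelled `HSub.hSub` (the `binop%` elaborator is pathologically
slow on this tower of adjunctions). [folklore] -/
theorem exists_const_sub_mem_nonunits (x : ↥(↥K)⟮z⟯)
    (hxO : x ∈ Valued.v.valuationSubring.comap (algebraMap (↥(↥K)⟮z⟯) ((ZMod p)⸨X⸩))) :
    ∃ kc : ↥K, algebraMap (↥K) (↥(↥K)⟮z⟯) kc ∈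
        Valued.v.valuationSubring.comap (algebraMap (↥(↥K)⟮z⟯) ((ZMod p)⸨X⸩)) ∧
      HSub.hSub x (algebraMap (↥K) (↥(↥K)⟮z⟯) kc) ∈
        (Valued.v.valuationSubring.comap (algebraMap (↥(↥K)⟮z⟯) ((ZMod p)⸨X⸩))).nonunits := by
  have hvx : Valued.v (algebraMap (↥(↥K)⟮z⟯) ((ZMod p)⸨X⸩) x) ≤ (1 : ℤᵐ⁰) :=
    (Valuation.mem_valuationSubring_iff _ _).mp (ValuationSubring.mem_comap.mp hxO)
  have hx1 := valuation_sub_C_coeff_zero_le (ZMod p) hvx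
  obtain ⟨c₀, hc₀⟩ : ∃ c₀ : ZMod p, (algebraMap (↥(↥K)⟮z⟯) ((ZMod p)⸨X⸩) x).coeff 0 = c₀ :=
    ⟨_, rfl⟩
  rw [hc₀] at hx1
  -- the constant `c₀` as an element `kc ∈ K`
  obtain ⟨kc, hkc⟩ : ∃ kc : ↥K, ((c₀.val : ℕ) : ↥K) = kc := ⟨_, rfl⟩
  have hkcM : algebraMap (↥K) ((ZMod p)⸨X⸩) kc = HahnSeries.C c₀ := by
    rw [← hkc, map_natCast, ← map_natCast (HahnSeries.C (Γ := ℤ) (R := ZMod p)),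
      ZMod.natCast_zmod_val]
  have haM : algebraMap (↥(↥K)⟮z⟯) ((ZMod p)⸨X⸩) (algebraMap (↥K) (↥(↥K)⟮z⟯) kc) =
      HahnSeries.C c₀ :=
    (IsScalarTower.algebraMap_apply (↥K) (↥(↥K)⟮z⟯) ((ZMod p)⸨X⸩) kc).symm.trans hkcM
  refine ⟨kc, ?_, ?_⟩
  · rw [ValuationSubring.mem_comap, Valuation.mem_valuationSubring_iff, haM]
    exact valuation_C_le_one (ZMod p) c₀
  · rw [mem_nonunits_comap_iff, mem_nonunits_valuationSubring_iff,
      map_sub (algebraMap (↥(↥K)⟮z⟯) ((ZMod p)⸨X⸩)) x (algebraMap (↥K) (↥(↥K)⟮z⟯) kc), haM]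
    refine hx1.trans_lt ?_
    rw [← exp_zero, exp_lt_exp]
    decide

/-- **`f = 1`**: every residue of `L° = K(z) ∩ 𝔽_p⟦X⟧` is the residue of a constant
`c ∈ 𝔽_p ⊆ K`. [folklore] -/
theorem residueSubfield_eq_top :
    residueSubfield (↥K) (Valued.v.valuationSubring.comap (algebraMap (↥(↥K)⟮z⟯) ((ZMod p)⸨X⸩)))
      = ⊤ := by
  refine eq_top_iff.mpr fun r _ => ?_
  obtain ⟨⟨x, hxO⟩, rfl⟩ := IsLocalRing.residue_surjective r
  obtain ⟨kc, hkc, hcongr⟩ := exists_const_sub_mem_nonunits p K z x hxO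
  rw [residue_eq_residue_of_sub_mem_nonunits _ hxO hkc hcongr]
  exact residue_mem_residueSubfield (↥K) _ kc hkc

/-- **`f_{L/K} = 1`** for `L° = K(z) ∩ 𝔽_p⟦X⟧` over `K`. [folklore] -/
theorem inertiaDegree_eq_one :
    inertiaDegree (↥K) (Valued.v.valuationSubring.comap (algebraMap (↥(↥K)⟮z⟯) ((ZMod p)⸨X⸩)))
      = 1 := by
  unfold inertiaDegree
  rw [residueSubfield_eq_top p K z]
  exact finrank_top_subfield _

/-- **The defect criterion.** Let `K ⊆ 𝔽_p((X))` be a subfield with `X ∈ K`, and `z ∈ 𝔽_p((X))`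
with `z^p ∈ K`, `z ∉ K`. Then `(K, K ∩ 𝔽_p⟦X⟧)` is NOT defectless in `L = K(z)`: `[L : K] = p`,
the extension of the valuation is unique and immediate (`e = f = 1`), so `∑ eᵢfᵢ = 1 < p`
(Kuhlmann 2010, §2.3, p. 7: "If `[L:K] = p` then `(L|K,v)` has non-trivial defect if and only
if it is immediate, i.e., `(vL:vK) = 1` and `[Lv:Kv] = 1`"). [folklore] -/
theorem not_isDefectlessIn (ht : (HahnSeries.single 1 1 : (ZMod p)⸨X⸩) ∈ K) (hzp : z ^ p ∈ K)
    (hz : z ∉ K) :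
    ¬ IsDefectlessIn (↥K) (Valued.v.valuationSubring.comap (algebraMap (↥K) ((ZMod p)⸨X⸩)))
      (↥(↥K)⟮z⟯) := by
  classical
  rintro ⟨s, hs, hsum⟩
  set OL := Valued.v.valuationSubring.comap (algebraMap (↥(↥K)⟮z⟯) ((ZMod p)⸨X⸩)) with hOL
  have hs' : s = {OL} :=
    Finset.eq_singleton_iff_unique_mem.mpr ⟨(hs OL).mpr (comap_comap_eq p K z),
      fun O' hO' => eq_comap_of_comap_eq p K z hzp O' ((hs O').mp hO')⟩
  rw [hs', Finset.sum_singleton, hOL, ramificationIndex_eq_one p K z ht, inertiaDegree_eq_one,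
    finrank_eq p K z hzp hz, mul_one] at hsum
  exact hp.out.one_lt.ne hsum

/-- Hence such a `(K, K ∩ 𝔽_p⟦X⟧)` is **not a defectless (stable) field** (`IsDefectlessField`,
Kuhlmann 2010, §1, p. 3). [folklore] -/
theorem not_isDefectlessField (ht : (HahnSeries.single 1 1 : (ZMod p)⸨X⸩) ∈ K) (hzp : z ^ p ∈ K)
    (hz : z ∉ K) :
    ¬ IsDefectlessField (↥K) (Valued.v.valuationSubring.comap (algebraMap (↥K) ((ZMod p)⸨X⸩))) := by
  intro h
  haveI : FiniteDimensional (↥K) (↥(↥K)⟮z⟯) := adjoin.finiteDimensional (isIntegral_gen p K z hzp)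
  exact not_isDefectlessIn p K z ht hzp hz (h (↥(↥K)⟮z⟯) inferInstance)

/-- **F. K. Schmidt's example**: for `z ∈ 𝔽_p((X))` transcendental over `𝔽_p(X)`, the subfield
`K = 𝔽_p(X, z^p)` contains `X` and `z^p` but not `z` (a transcendental `z` never lies in
`F(zⁿ)`, `n ≥ 2`), so `(K, K ∩ 𝔽_p⟦X⟧)` is not a defectless field. [folklore] -/
theorem not_isDefectlessField_adjoin
    (hz : Transcendental (↥(ZMod p)⟮(HahnSeries.single 1 1 : (ZMod p)⸨X⸩)⟯) z) :
    ¬ IsDefectlessField (↥(ZMod p)⟮(HahnSeries.single 1 1 : (ZMod p)⸨X⸩), z ^ p⟯)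
      (Valued.v.valuationSubring.comap
        (algebraMap (↥(ZMod p)⟮(HahnSeries.single 1 1 : (ZMod p)⸨X⸩), z ^ p⟯) ((ZMod p)⸨X⸩))) := by
  refine not_isDefectlessField p _ z (subset_adjoin _ _ (by simp)) (subset_adjoin _ _ (by simp)) ?_
  intro hzK
  rw [← adjoin_simple_adjoin_simple, mem_restrictScalars] at hzK
  exact not_mem_adjoin_pow_of_transcendental hz hp.out.two_le hzK

end SchmidtDefect

/-- **Defect exists in every positive characteristic**: for every prime `p` there is a valued
field `(K, K°)` of characteristic `p` (namely `K = 𝔽_p(X, z^p) ⊂ 𝔽_p((X))`, `z` a transcendental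
power series, with the `X`-adic valuation ring `K ∩ 𝔽_p⟦X⟧`) which is not a defectless field —
in contrast with residue characteristic `0`, where every valued field is defectless (Kuhlmann
2010, Cor. 2.12). In particular the predicate `IsDefectlessField` is a genuine condition and
admits no unconditional `_holds` theorem. [folklore] -/
theorem exists_not_isDefectlessField (p : ℕ) [Fact p.Prime] :
    ∃ (K : Type) (_ : Field K) (O : ValuationSubring K), CharP K p ∧ ¬ IsDefectlessField K O := by
  obtain ⟨z, hz⟩ :=
    exists_transcendental_laurentSeries p (HahnSeries.single 1 1 : (ZMod p)⸨X⸩)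
  exact ⟨_, inferInstance, _, charP_of_injective_algebraMap (algebraMap (ZMod p) _).injective p,
    SchmidtDefect.not_isDefectlessField_adjoin p z hz⟩

/-- The universal closure of `IsDefectlessField` is false: not every valued field is defectless
(stable). [folklore] -/
theorem not_forall_isDefectlessField :
    ¬ ∀ (K : Type) [Field K] (O : ValuationSubring K), IsDefectlessField K O := by
  intro h
  haveI : Fact (Nat.Prime 2) := ⟨Nat.prime_two⟩
  obtain ⟨K, _, O, -, hK⟩ := exists_not_isDefectlessField 2
  exact hK (h K O)

end Literature.AlgebraicGeometry.Resolution
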